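import Summits.ABC.ABC.Theses.StormerPellDescent
import Summits.ABC.Harvest.ConsecutiveABC
import HarnessLib

/-!
# Route StormerPellDescent — item `Assembly` (stmt-ABC-22190) and the Størmer–Pell dictionary

`Summit.ABC.ABC.Theses.StormerPellDescent.Assembly := UnitPowerRadical → FundamentalUnitRadical →
OffConsecutiveABC → ABC` (route-ABC-StormerPellDescent, abc-idea-3; critic idea-crit-6 2026-08-27: «GENUINELY
PROVABLE NOW … it is the certified Størmer dictionary»). Cell `abc-harv`, seat abc-harv-pr-2 (after KEY
G29-CONSECUTIVE-DOOR: the door `Summit.ABC.Harvest.ConsecutiveABC` = abc on `(1, n, n+1)`, ★ p573323).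

PROOF-ONLY file (no definition, no `sorry`, no named fact, standard axioms). Content:

* §1 arithmetic of the Størmer substitution: `b²·d = 4n(n+1) ⇒ rad(d·b) = rad(n(n+1))`
  (`radical_eq_of_sq_mul_eq`, the `4` is absorbed because `2 ∣ n(n+1)`); `rad(d·Y²·X²) ≤ rad(d·Y)·X`.
* §2 **Størmer descent** `consecutiveABC_of_units : UnitPowerRadical → FundamentalUnitRadical → ConsecutiveABC`:
  for `n ≥ 1` write `4n(n+1) = b²d` with `d` squarefree (`Nat.sq_mul_squarefree_of_pos`); `(2n+1)² − d b² = 1`, so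
  `(2n+1, b)` is a positive solution of Pell's equation, i.e. a power `a₁^k`, `k ≥ 1`, of the fundamental solution
  (Mathlib `Pell.IsFundamental.exists_of_not_isSquare`, `Pell.IsFundamental.eq_pow_of_nonneg`; `k = 0` is impossible
  since `x = 2n+1 > 1`); the crux inequalities (`k = 1`: `FundamentalUnitRadical`, `k ≥ 2`: `UnitPowerRadical`,
  combined in `pellRadical_of_units`) give `n + 1 ≤ 2n+1 < C·rad(d b)^{1+ε} = C·rad(n(n+1))^{1+ε}`. This is the
  classical dictionary (Størmer 1897 / Lehmer 1964) — no novelty is claimed; it is the CERTIFIED split.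
* §3 the **converse** `pellRadical_of_consecutiveABC`: consecutive abc gives the unit inequality for EVERY `d : ℕ` and
  every solution with `x > 0` (pair `n = d y² = x² − 1`, `n + 1 = x²`; `rad(d y² x²) ≤ rad(d y)·x`, the `x` inside the
  radical costs an exponent loss absorbed by `ε₀ = ε/(2+ε)`, `lt_rpow_mul_rpow_of_sq_lt`); hence
  `consecutiveABC_iff_units : ConsecutiveABC ↔ FundamentalUnitRadical ∧ UnitPowerRadical` — the two cruxes together
  are EXACTLY the door «CONS» (so each is at most CONS-strength and their conjunction is CONS; neither is abc).
* §4 `stormerPellDescent_assembly : Assembly` (= §2 + the case split `min(a,b) = 1 ∨ ≥ 2`,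
  `Summit.ABC.Harvest.abc_of_consecutiveABC_of_offFamily`), `offConsecutiveABC_of_abc`, and the exact accounting
  `abc_iff_units_and_offConsecutiveABC : ABC ↔ FundamentalUnitRadical ∧ UnitPowerRadical ∧ OffConsecutiveABC`.

HONESTY: nothing here attacks any conjunct; `UnitPowerRadical`, `FundamentalUnitRadical` (jointly = CONS, NOT abc) and
`OffConsecutiveABC` (abc-strength residual) stay OPEN; abc is not proved by any of this; A-PS is NOT abc.
[cite: BombieriGubler2006, Conj. 12.2.2] (the abc sentence); the dictionary is [folklore] (Størmer 1897, Lehmer 1964;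
Mathlib `Mathlib.NumberTheory.Pell`).
-/

noncomputable section

-- `Summit.<Summit>.<Problem>` is the mandated summit-side namespace (CONVENTIONS §2); for the
-- single-conjunct summit `ABC` the two coincide, so the duplicate `ABC.ABC` is deliberate.
set_option linter.dupNamespace false

namespace Summit.ABC.ABC.Theorems

open UniqueFactorizationMonoid
open Literature.NumberTheory.DiophantineGeometry
open Summit.ABC.Harvest
open Summit.ABC.ABC.Theses.StormerPellDescent
/-! ## §1 Arithmetic of the Størmer substitution `4n(n+1) = d·y²`, `x = 2n+1` -/

/-- If `b² · d = 4 · n(n+1)` with `n ≥ 1` then `rad(d · b) = rad(n(n+1))` (`2 ∣ n(n+1)` absorbs the `4`).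
[folklore] -/
theorem radical_eq_of_sq_mul_eq {d b n : ℕ} (hn : 0 < n) (h : b ^ 2 * d = 4 * (n * (n + 1))) :
    radical (d * b) = radical (n * (n + 1)) := by
  have hN : n * (n + 1) ≠ 0 := by positivity
  have hb : b ≠ 0 := by rintro rfl; omega
  have hd : d ≠ 0 := by rintro rfl; omega
  rw [Nat.radical_eq_prod_primeFactors, Nat.radical_eq_prod_primeFactors]
  congr 1
  calc (d * b).primeFactors = d.primeFactors ∪ b.primeFactors := Nat.primeFactors_mul hd hb
    _ = (b ^ 2 * d).primeFactors := by
        rw [Nat.primeFactors_mul (pow_ne_zero _ hb) hd, Nat.primeFactors_pow _ two_ne_zero, Finset.union_comm]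
    _ = (4 * (n * (n + 1))).primeFactors := by rw [h]
    _ = (4 : ℕ).primeFactors ∪ (n * (n + 1)).primeFactors := Nat.primeFactors_mul (by norm_num) hN
    _ = {2} ∪ (n * (n + 1)).primeFactors := by
        rw [show (4 : ℕ) = 2 ^ 2 by norm_num, Nat.primeFactors_prime_pow two_ne_zero Nat.prime_two]
    _ = (n * (n + 1)).primeFactors := by
        rw [Finset.union_eq_right, Finset.singleton_subset_iff, Nat.mem_primeFactors]
        exact ⟨Nat.prime_two, (Nat.even_mul_succ_self n).two_dvd, hN⟩

/-- `rad(d · Y² · X²) ≤ rad(d · Y) · X` for nonzero `d, X, Y`. [folklore] -/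
theorem radical_mul_sq_mul_sq_le {d X Y : ℕ} (hX : X ≠ 0) (hY : Y ≠ 0) (hd : d ≠ 0) :
    radical (d * Y ^ 2 * X ^ 2) ≤ radical (d * Y) * X := by
  have h1 : radical (d * Y ^ 2 * X ^ 2) ∣ radical (d * Y ^ 2) * radical (X ^ 2) := radical_mul_dvd
  rw [radical_pow X two_ne_zero] at h1
  have h2 : radical (d * Y ^ 2) = radical (d * Y) := by
    rw [Nat.radical_eq_prod_primeFactors, Nat.radical_eq_prod_primeFactors,
      Nat.primeFactors_mul hd (pow_ne_zero _ hY), Nat.primeFactors_pow _ two_ne_zero,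
      ← Nat.primeFactors_mul hd hY]
  rw [h2] at h1
  calc radical (d * Y ^ 2 * X ^ 2) ≤ radical (d * Y) * radical X := Nat.le_of_dvd (by positivity) h1
    _ ≤ radical (d * Y) * X := Nat.mul_le_mul_left _ (Nat.radical_le_self_iff.mpr hX)

/-! ## §2 Units ⟹ consecutive abc (the Størmer descent) -/

/-- The two cruxes combined: the Pell-unit inequality at every index `k ≥ 1` with `C = max(C₁, C₂)`. [folklore] -/
theorem pellRadical_of_units (hU : UnitPowerRadical) (hF : FundamentalUnitRadical) :
    ∀ ε : ℝ, 0 < ε → ∃ C : ℝ, 0 < C ∧ ∀ d : ℕ, Squarefree d → ∀ a : Pell.Solution₁ (d : ℤ),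
      Pell.IsFundamental a → ∀ k : ℕ, 1 ≤ k →
        ((a ^ k).x : ℝ) < C * ((radical (d * (a ^ k).y.natAbs) : ℕ) : ℝ) ^ (1 + ε) := by
  intro ε hε
  obtain ⟨C₁, hC₁, h₁⟩ := hF ε hε
  obtain ⟨C₂, -, h₂⟩ := hU ε hε
  refine ⟨max C₁ C₂, lt_max_iff.mpr (Or.inl hC₁), fun d hd a ha k hk ↦ ?_⟩
  rcases Nat.lt_or_ge k 2 with hk2 | hk2
  · obtain rfl : k = 1 := by omega
    rw [pow_one]
    exact (h₁ d hd a ha).trans_le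
      (mul_le_mul_of_nonneg_right (le_max_left _ _) (Real.rpow_nonneg (Nat.cast_nonneg _) _))
  · exact (h₂ d hd a ha k hk2).trans_le
      (mul_le_mul_of_nonneg_right (le_max_right _ _) (Real.rpow_nonneg (Nat.cast_nonneg _) _))

/-- **Størmer descent**: `UnitPowerRadical → FundamentalUnitRadical → ConsecutiveABC`. For `n ≥ 1` write
`4n(n+1) = b² d` with `d` squarefree (`Nat.sq_mul_squarefree_of_pos`); then `(2n+1)² − d b² = 1`, so
`(2n+1, b)` is a positive solution of the Pell equation, hence a power `a₁^k` (`k ≥ 1`) of the fundamental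
solution (`Pell.IsFundamental.eq_pow_of_nonneg`); the unit inequality gives `2n+1 < C · rad(d b)^{1+ε}` and
`rad(d b) = rad(n(n+1))`. [folklore] -/
theorem consecutiveABC_of_units (hU : UnitPowerRadical) (hF : FundamentalUnitRadical) : ConsecutiveABC := by
  intro ε hε
  obtain ⟨C, hC, h⟩ := pellRadical_of_units hU hF ε hε
  refine ⟨C, hC, fun n hn ↦ ?_⟩
  obtain ⟨d, b, -, -, hbd, hd⟩ :=
    Nat.sq_mul_squarefree_of_pos (show 0 < 4 * (n * (n + 1)) by positivity)
  have hsol : (2 * (n : ℤ) + 1) ^ 2 - (d : ℤ) * (b : ℤ) ^ 2 = 1 := by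
    have hz : ((b ^ 2 * d : ℕ) : ℤ) = ((4 * (n * (n + 1)) : ℕ) : ℤ) := by rw [hbd]
    push_cast at hz
    linear_combination (-1 : ℤ) * hz
  obtain ⟨s, hsx, hsy⟩ : ∃ s : Pell.Solution₁ (d : ℤ), s.x = 2 * (n : ℤ) + 1 ∧ s.y = b :=
    ⟨Pell.Solution₁.mk _ _ hsol, Pell.Solution₁.x_mk _ _ _, Pell.Solution₁.y_mk _ _ _⟩
  have hn1 : (1 : ℤ) ≤ n := by exact_mod_cast hn
  have hx1 : 1 < s.x := by rw [hsx]; linarith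
  obtain ⟨a₁, ha₁⟩ := Pell.IsFundamental.exists_of_not_isSquare
    (Pell.Solution₁.d_pos_of_one_lt_x hx1) (Pell.Solution₁.d_nonsquare_of_one_lt_x hx1)
  obtain ⟨k, hk⟩ := ha₁.eq_pow_of_nonneg (zero_lt_one.trans hx1) (by rw [hsy]; positivity)
  have hk1 : 1 ≤ k := by
    by_contra hk0
    obtain rfl : k = 0 := by omega
    rw [pow_zero] at hk
    have := hx1
    rw [hk, Pell.Solution₁.x_one] at this
    exact lt_irrefl _ this
  have hb := h d hd a₁ ha₁ k hk1
  rw [← hk, hsx, hsy, Int.natAbs_natCast, radical_eq_of_sq_mul_eq hn hbd] at hb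
  push_cast at hb
  have hle : ((n + 1 : ℕ) : ℝ) ≤ 2 * (n : ℝ) + 1 := by push_cast; linarith [(Nat.cast_nonneg n : (0 : ℝ) ≤ n)]
  exact hle.trans_lt hb

/-! ## §3 Consecutive abc ⟹ units (converse; exponent bookkeeping `ε₀ = ε/(2+ε)`) -/

/-- Real-analysis core of the converse: from `X² < C · (R·X)^{1+ε/(2+ε)}` with `X, R ≥ 1` deduce
`X < C^{(2+ε)/2} · R^{1+ε}` (take logarithms; `(1 + ε/(2+ε)) · (2+ε)/2 = 1 + ε`). [folklore] -/
theorem lt_rpow_mul_rpow_of_sq_lt {X R C ε : ℝ} (hX : 1 ≤ X) (hR : 1 ≤ R) (hC : 0 < C) (hε : 0 < ε)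
    (h : X ^ 2 < C * (R * X) ^ (1 + ε / (2 + ε))) :
    X < C ^ ((2 + ε) / 2) * R ^ (1 + ε) := by
  have hX0 : 0 < X := by linarith
  have hR0 : 0 < R := by linarith
  have h2e : 0 < 2 + ε := by linarith
  have hp : 0 < (2 + ε) / 2 := by positivity
  have hlog := Real.log_lt_log (by positivity) h
  rw [Real.log_pow, Real.log_mul hC.ne' (by positivity), Real.log_rpow (by positivity),
    Real.log_mul hR0.ne' hX0.ne'] at hlog
  push_cast at hlog
  rw [← Real.log_lt_log_iff hX0 (by positivity), Real.log_mul (by positivity) (by positivity),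
    Real.log_rpow hC, Real.log_rpow hR0]
  have key : (1 + ε / (2 + ε)) * ((2 + ε) / 2) = 1 + ε := by field_simp; ring
  have h3 : (2 + ε) * Real.log X <
      (2 + ε) / 2 * Real.log C + (1 + ε) * (Real.log R + Real.log X) := by
    have := mul_lt_mul_of_pos_right hlog hp
    have e1 : 2 * Real.log X * ((2 + ε) / 2) = (2 + ε) * Real.log X := by ring
    have e2 : (Real.log C + (1 + ε / (2 + ε)) * (Real.log R + Real.log X)) * ((2 + ε) / 2) =
        (2 + ε) / 2 * Real.log C + ((1 + ε / (2 + ε)) * ((2 + ε) / 2)) * (Real.log R + Real.log X) := by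
      ring
    rwa [e1, e2, key] at this
  linarith

/-- **Consecutive abc ⟹ the Pell-unit inequality**, uniformly over all `d : ℕ` and all solutions with
`x > 0` (no squarefreeness or fundamentality needed): the pair `n = d y² = x² − 1`, `n + 1 = x²` is consecutive,
`rad(d y² x²) ≤ rad(d y) · x`, and the exponent loss `x` inside the radical is absorbed by
`ε₀ = ε/(2+ε)` (`lt_rpow_mul_rpow_of_sq_lt`); `C = max(2, C₀^{(2+ε)/2})` also covers the trivial solutions
(`y = 0` or `d = 0`, where `x = 1` and `rad(0) = 1`). [folklore] -/
theorem pellRadical_of_consecutiveABC (h : ConsecutiveABC) :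
    ∀ ε : ℝ, 0 < ε → ∃ C : ℝ, 0 < C ∧ ∀ d : ℕ, ∀ a : Pell.Solution₁ (d : ℤ), 0 < a.x →
      (a.x : ℝ) < C * ((radical (d * a.y.natAbs) : ℕ) : ℝ) ^ (1 + ε) := by
  intro ε hε
  obtain ⟨C₀, hC₀, hb⟩ := h (ε / (2 + ε)) (by positivity)
  refine ⟨max 2 (C₀ ^ ((2 + ε) / 2)), lt_max_iff.mpr (Or.inl two_pos), fun d a hax ↦ ?_⟩
  obtain ⟨X, hXx⟩ : ∃ X : ℕ, (X : ℤ) = a.x := ⟨a.x.natAbs, Int.natAbs_of_nonneg hax.le⟩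
  set Y := a.y.natAbs with hY
  have hprop : (X : ℤ) ^ 2 = 1 + d * (Y : ℤ) ^ 2 := by rw [hXx, hY, Int.natAbs_sq, a.prop_x]
  have hpropN : X ^ 2 = 1 + d * Y ^ 2 := by exact_mod_cast hprop
  have hR1 : (1 : ℝ) ≤ ((radical (d * Y) : ℕ) : ℝ) := by exact_mod_cast Nat.radical_pos _
  have hRpow : (1 : ℝ) ≤ ((radical (d * Y) : ℕ) : ℝ) ^ (1 + ε) := Real.one_le_rpow hR1 (by positivity)
  have hxR : (a.x : ℝ) = (X : ℝ) := by rw [← hXx]; push_cast; rfl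
  rw [hxR]
  by_cases hn : d * Y ^ 2 = 0
  · have hX1 : X = 1 := by
      rw [hn, add_zero] at hpropN
      exact (pow_eq_one_iff.mp hpropN).resolve_right two_ne_zero
    subst hX1
    calc ((1 : ℕ) : ℝ) < 2 * 1 := by norm_num
      _ ≤ max 2 (C₀ ^ ((2 + ε) / 2)) * ((radical (d * Y) : ℕ) : ℝ) ^ (1 + ε) :=
          mul_le_mul (le_max_left _ _) hRpow zero_le_one (by positivity)
  · have hd : d ≠ 0 := fun h0 ↦ hn (by rw [h0, zero_mul])
    have hY0 : Y ≠ 0 := fun h0 ↦ hn (by rw [h0]; simp)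
    have hX0 : X ≠ 0 := by rintro rfl; omega
    have hcons := hb (d * Y ^ 2) (Nat.pos_of_ne_zero hn)
    have hsucc : d * Y ^ 2 + 1 = X ^ 2 := by omega
    rw [hsucc] at hcons
    push_cast at hcons
    have hradle : ((radical (d * Y ^ 2 * X ^ 2) : ℕ) : ℝ) ≤ ((radical (d * Y) : ℕ) : ℝ) * X := by
      exact_mod_cast radical_mul_sq_mul_sq_le hX0 hY0 hd
    have hX1 : (1 : ℝ) ≤ X := by exact_mod_cast Nat.one_le_iff_ne_zero.mpr hX0
    have h2 : (X : ℝ) ^ 2 < C₀ * (((radical (d * Y) : ℕ) : ℝ) * X) ^ (1 + ε / (2 + ε)) := by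
      refine hcons.trans_le ?_
      gcongr
    calc (X : ℝ) < C₀ ^ ((2 + ε) / 2) * ((radical (d * Y) : ℕ) : ℝ) ^ (1 + ε) :=
          lt_rpow_mul_rpow_of_sq_lt hX1 hR1 hC₀ hε h2
      _ ≤ max 2 (C₀ ^ ((2 + ε) / 2)) * ((radical (d * Y) : ℕ) : ℝ) ^ (1 + ε) :=
          mul_le_mul_of_nonneg_right (le_max_right _ _) (by positivity)

/-- Consecutive abc ⟹ the `k = 1` crux `FundamentalUnitRadical`. [folklore] -/
theorem fundamentalUnitRadical_of_consecutiveABC (h : ConsecutiveABC) : FundamentalUnitRadical := by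
  intro ε hε
  obtain ⟨C, hC, hb⟩ := pellRadical_of_consecutiveABC h ε hε
  exact ⟨C, hC, fun d _ a ha ↦ hb d a ha.x_pos⟩

/-- Consecutive abc ⟹ the `k ≥ 2` crux `UnitPowerRadical`. [folklore] -/
theorem unitPowerRadical_of_consecutiveABC (h : ConsecutiveABC) : UnitPowerRadical := by
  intro ε hε
  obtain ⟨C, hC, hb⟩ := pellRadical_of_consecutiveABC h ε hε
  exact ⟨C, hC, fun d _ a ha n _ ↦ hb d (a ^ n) (Pell.Solution₁.x_pow_pos ha.x_pos n)⟩

/-- **The Størmer–Pell dictionary**: consecutive abc is EQUIVALENT to the conjunction of the two unit cruxes of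
`route-ABC-StormerPellDescent`. [folklore] -/
theorem consecutiveABC_iff_units : ConsecutiveABC ↔ FundamentalUnitRadical ∧ UnitPowerRadical :=
  ⟨fun h ↦ ⟨fundamentalUnitRadical_of_consecutiveABC h, unitPowerRadical_of_consecutiveABC h⟩,
    fun h ↦ consecutiveABC_of_units h.2 h.1⟩

/-! ## §4 The route's `Assembly` item and the residual bookkeeping -/

/-- **Item `Assembly` of route StormerPellDescent (stmt-ABC-22190)**:
`UnitPowerRadical → FundamentalUnitRadical → OffConsecutiveABC → ABC` — the Størmer descent
(`consecutiveABC_of_units`) followed by the case split `min(a,b) = 1 ∨ min(a,b) ≥ 2`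
(`Summit.ABC.Harvest.abc_of_consecutiveABC_of_offFamily`). [folklore] -/
theorem stormerPellDescent_assembly : Assembly :=
  fun hU hF hOff ↦ abc_of_consecutiveABC_of_offFamily (consecutiveABC_of_units hU hF) hOff

/-- abc ⟹ the residual `OffConsecutiveABC` (restriction). [folklore] -/
theorem offConsecutiveABC_of_abc (habc : ABC) : OffConsecutiveABC :=
  fun ε hε ↦ (habc ε hε).imp fun _ hC ↦ ⟨hC.1, fun a b c ht _ ↦ hC.2 a b c ht⟩

/-- **Exact accounting of the line**: `ABC ↔ FundamentalUnitRadical ∧ UnitPowerRadical ∧ OffConsecutiveABC`.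
Nothing here attacks any conjunct; abc is not proved by any of this. [folklore] -/
theorem abc_iff_units_and_offConsecutiveABC :
    ABC ↔ FundamentalUnitRadical ∧ UnitPowerRadical ∧ OffConsecutiveABC := by
  constructor
  · intro h
    have hc := consecutiveABC_of_abc h
    exact ⟨fundamentalUnitRadical_of_consecutiveABC hc, unitPowerRadical_of_consecutiveABC hc,
      offConsecutiveABC_of_abc h⟩
  · rintro ⟨hF, hU, hOff⟩
    exact stormerPellDescent_assembly hU hF hOff

end Summit.ABC.ABC.Theorems

end
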